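import Summits.BirchSwinnertonDyer.BirchSwinnertonDyer.Theorems.ManinLocalTwoThreeSigmaSquareRootLeaves
import Summits.BirchSwinnertonDyer.Rank1Residual.ManinAdditive.ShimuraKernel
import Summits.BirchSwinnertonDyer.Rank1Residual.ManinAdditive.CuspidalKummerEvenResidual
import HarnessLib
import HarnessLib.Audit.Tags

/-!
# NODES of the all-even Kummer / Shimura-2-kernel position file (statement layer, `Theses`-free import cone; C2 line `ManinOddAtFour`,
# stmt-BirchSwinnertonDyer-22967; cell bsd-f2-manin, seat -an g42)

SPLIT BY IMPORT CONE (T-an-57 precedent): this LEAF holds the typed nodes E-an-237, S-an-g42-1, 6b-res♮|_A, 6b-res|_B, E-an-152|_B, E-an-152b|_B,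
E-an-153|_B and the pure restriction edges; every theorem that needs the `Theses.ManinLocalTwoThree` cone (p2 `UDCTwo`, LEAD `SigmaHabitat`,
`SquareRootDescent`) lives in the companion `Theorems/ManinLocalTwoThreeEvenKummerShimuraPosition.lean` (source HOME/an/g42/EvenKummerShimuraPositionHolds-an-g42.lean),
whose content is described below for orientation.

Answer to LEAD-MEMO v35 §4 -an asks (a) «E-an-152/152b/153 restricted to B» and (b) «is 6b‴ ⟺ "T ∉ ker(E₀ → E₁)" kernel-provable?
(then 6b‴|_A is free)».  Locus A = `modularSymbol D.f 0 ∈ periodLattice D.f` (⊇ root number `−1`), locus B = its complement (analytic rank 0).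

ONE new node, everything else PROVED from it and the tree (no sorry):

* §1 **E-an-237 `EvenKummerRepCongruencePeriodic`** (`@[conjecture]`, THEOREM-CANDIDATE, prover-sized in three stubs): if the Kummer series
  `Ξ_T` of a rational `2`-torsion point `T = (e, 0)` has a cuspidal Kummer representative `Ξ_T·B²·Xⁿ¹ = Xⁿ²·g·A²` (`IsCuspidalKummerRep`) whose
  η-exponent vector `r` is ALL EVEN, then for every half-period `p` of `T` (`p ∉ Λ_W`, `2p = m₁ω₁ + m₂ω₂`, `℘(p) = e + b₂/12`) the σ-square root
  `V_p = sigmaSqRoot Λ_W p (m₁η₁ + m₂η₂)` is periodic under `c·{∞,γ∞}_f` for every `γ ∈ Γ₀(N) ∩ Γ(8N)` — the CONGRUENCE hypothesis `hcong`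
  (`M = 8N`) of p2's NC₂-glue `UDCTwo.sigmaSqRoot_gamma1_periodic_of_congruence`.  MECHANISM (why no UDC / CDT input is needed on the all-even
  locus): with `s = r/2`, `√Ξ_T = ± q^{(n₂−n₁)/2}·ĝ_s·(A/B) = ± η_s(τ)·F(τ)`, `F ∈ ℚ(X₀(N))`; `η_s = ∏ η(δτ)^{s_δ}` satisfies `Σ s_δ = 0`,
  `12 ∣ Σ δ s_δ`, `12 ∣ Σ (N/δ) s_δ` (halves of `NewmanCond N r 0`) but NOT Newman's square condition, so by the η-multiplier system
  (`Literature…ModularCurveEtaQuotientsProofs`: `eta_SL2_smul`, `etaMultiplier_of_odd_d`, `newman_exponent_sum_dvd`, `newman_jacobi_prod_eq_one`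
  minus its `hsq`) `η_s(γτ) = χ(γ)·η_s(τ)` on `Γ₀(N)` with `χ(γ) = ζ₂₄^{(…)·S₂ + b d·S₁}·(∏ δ^{|s_δ|} / |d|)`, and BOTH factors are `1` when
  `γ ≡ 1 (mod 8N)` (`8 ∣ b, 8 ∣ c/N`, `12 ∣ S₁, S₂`; `d ≡ ±1 (mod 8N)` ⟹ `(2/|d|) = 1` and `(ℓ/|d|) = 1` for every odd prime `ℓ ∣ N` by
  reciprocity).  So `√Ξ_T` is a meromorphic function on `ℍ` invariant under `Γ₀(N) ∩ Γ(8N)`; p2's dictionary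
  (`KummerSquareRootDictionary.exists_hasSum_const_mul_shortT_mul_sigmaSqRoot`: `√Ξ_T = κ·t_s·V_p(c·E_f)` near `i∞`, `κ ≠ 0`) and multiplier
  (`exists_sqMultiplier_gamma`, `forall_gamma_smul_eq_iff_sigmaSqRoot_periodic`) turn this into the periodicity of `V_p`.
  STUBS for the prover: (α) `η_s` is `Γ₀(N) ∩ Γ(8N)`-invariant under the three congruences above [pure η-arithmetic, the tree lemmas + Mathlib
  `jacobiSym.quadratic_reciprocity` / `jacobiSym.at_two`]; (β) formal: all-even rep ⟹ `h := X^{(n₂−n₁)/2}·g_s·A/B ∈ ℚ⟦X⟧`, `h² = Ξ_T`, `h(0) = ±1`,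
  `g = g_s²` for the `IsEtaUnitSeries` of `s` (`SquareRootDescent.etaLaurent_half_sq` shape); (γ) analytic continuation: `t_s·V_p(c·E_f)` is
  meromorphic on `ℍ` and equals `κ⁻¹·η_s·F` near `i∞`, hence `G₂(γτ₀) = G₂(τ₀)` at one point with `G₂(τ₀) ≠ 0`, which is all
  `forall_gamma_smul_eq_iff_sigmaSqRoot_periodic`'s proof uses (`ρ_γ = 1`).  Stub (α) is TYPED here as the support node **S-an-g42-1
  `EtaQuotientInvariantOfHalfNewman`** (pure η-arithmetic over `etaQuotient`; M-sized); (γ) is, as of 22:08Z, essentially the LEAD's (DICT₂)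
  `MinimalDictionaryTwo.kummerMinimalDictionaryTwo` (p747636) + p2's HOLB₂ (p747200) machinery.
* §2 PROVED — **6b-res IS FREE ON LOCUS A** (answer to (b), second half): `false_of_allEven_of_modularSymbol_zero_mem_of_print` — modulo E-an-237
  and the three PRINTED cusp facts F★ `optimalGamma1Parametrization_cusp_rational`, F♮ `optimalGamma1Parametrization_cuspZero_galoisConjugate`,
  CES `exists_optimal_gamma1ParametrizationData`, on locus A NO rational `2`-torsion point (blind or not, ANY level `N`) has an all-even cuspidal
  Kummer representative (E-an-237 ⟹ `hcong` ⟹ p2 `UDCTwo.modularSymbol_zero_not_mem_of_congruence_of_print`); root-number-`−1` form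
  `false_of_allEven_of_rootNumber_eq_neg_one_of_print`; hence the named restrictions **6b-res♮|_A `CuspidalKummerEvenExponentSquareAtCuspZero`**
  and 6b‴|_A hold (`…AtCuspZero_of_congruencePeriodic_of_print`).  No blindness row, no UDC, no CDT is consumed on locus A.
* §3 PROVED — **ON THE CORE, 6b-res♮ ⟸ E-an-237 ∧ E-an-152 ∧ E-an-152b** (answer to (b), first half, typed):
  `cuspidalKummerEvenExponentSquare_of_congruencePeriodic_of_kernelRows` — E-an-237 ⟹ `hcong` ⟹ NC₂-glue ⟹ `Γ₁(N)`-periodicity of `V_p` ⟹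
  LEAD's dichotomy `SigmaHabitat.periodLatticeGamma1_eq_kummerLineTwo_or_eq_two_mul` (`Λ₁ = ℤ·(2p/c) + 2Λ₀` or `Λ₁ = 2Λ₀`); the second is
  ¬E-an-152b; in the first, `w := 2p/c ∈ Λ₁(f) ∖ 2Λ₀(f)` and `Λ₁ ≠ Λ₀` (`periodLatticeGamma1_ne_of_sigmaSqRoot_gamma1_periodic`), so E-an-152
  `ShimuraKernelBlindAtFour` produces a blind root `E` with `℘(c·w/2) = ℘(p) = E + a₂/3`, i.e. `E = e` — contradicting `¬ KummerBlindAtTwo a₂ a₄ e`.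
  So «6b‴ ⟺ T ∉ ker(E₀ → E₁)» is kernel-provable in the direction C2 needs, GIVEN E-an-237: the all-even class forces `T` to generate the Shimura
  `2`-kernel (position), and the kernel generator is blind by E-an-152 (= `ord₂ c₀ = ord₂ c₁` on index `≡ 2 (mod 4)`, MEMO-an §76).  Corollaries by
  name: 6b-res `CuspidalKummerEvenExponentSquareOnCore`, 6b‴ `CuspidalKummerOddExponentOnCore` (p2 `SquareRootDescent…_of_isSquare_half`) and
  E-an-53|₄ `CuspidalKummerOddExponent` from the same three rows.
* §4 TYPED + PROVED — the C2 v25 stub **6b-res|_B `CuspidalKummerEvenExponentSquareOnCoreB`** (VERBATIM type of `stub_cuspidalKummerEvenExponentSquareOnCoreB`),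
  `6b-res|_B ⟺ 6b-res` modulo E-an-237 ∧ print, and the by-name target **`cuspidalKummerEvenExponentSquareOnCoreB_of_congruencePeriodic_of_B_of_print` :
  E-an-237 → F★ → F♮ → CES → E-an-152|_B → E-an-152b|_B → 6b-res|_B**.  **Ask (a): restricting E-an-152 / E-an-152b / E-an-153 to locus B costs nothing**: the B-forms `ShimuraKernelBlindAtFourB`,
  `ShimuraIndexNeFourAtFourB`, `ShimuraTrivialOfNoBlindAtFourB` (extra binder `modularSymbol D₀.f 0 ∉ periodLattice D₀.f`) are EQUIVALENT to the
  originals modulo F★, F♮, CES (`…_of_B_of_print`, `…B_of_…`), because their own hypotheses (`Λ₁ ≠ Λ₀`, resp. index `4`) already put the class on B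
  (LEAD `modularSymbol_zero_not_mem_of_ne_of_print`, `…_of_index_four_of_print`) and on A the conclusion of E-an-153 is LEAD's
  `periodLatticeGamma1_eq_of_modularSymbol_zero_mem_of_print`.  On B they are NOT free: they are the rows of MEMO-an §76 (blind ⟺ the Vélu model of
  `E₀/⟨T⟩` is non-minimal at `2` ⟺ `c_ψ = 2` for the `2`-isogeny `ψ : E₀ → E₀/⟨T⟩`).
* §5 PROVED — the literal POSITION biconditional behind (b): `sigmaSqRoot_gamma1_periodic_iff_le_kummerLineTwo` — `V_p` is `Γ₁(N)`-periodic
  ⟺ `Λ₁(f) ⊆ ℤ·(2p/c) + 2Λ₀(f)` (⟹ LEAD `periodLatticeGamma1_le_kummerLineTwo`; ⟸ p2 `UDCTwo.sigmaSqRoot_periodic_of_mem_kummerTwo`), i.e.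
  ⟺ `T_p ∈ ker(E₀ → E₁)` for lattice-optimal `D`.

BC5 WITNESS (two engines, 4 ∣ N ≤ 2000): -data `KUMMER-4N2000-v1.tsv` (sha16 0b93399eaa2a726a; 1047 cuspidal candidate `2`-torsion roots) ×
-es `E15-LATTICE-INDEX-v1.tsv`: an ALL-EVEN exponent vector occurs for exactly 19/1047 roots; all 19 are BLIND (0/1016 non-blind roots are
all-even — 6b-res♮'s hypothesis is empty in range), all 19 classes have `[Λ₀(f):Λ₁(f)] = 2` and rank `0` (locus B, as §2 predicts), the 19 classes
ARE the 19 index-2 classes at `4 ∣ N ≤ 2000` (20a,24a,32a,40a,48a,52a,64a,80a,80b,116c,128b,128d,208c,212b,464e,692a,848d,916a,1172a), and the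
all-even root's quotient `E₀/⟨T⟩` is the Stevens curve `E₁` every time (24a4, 40a3, 48a4, 64a4, 80a2 in the five full-`2`-torsion classes) —
exactly the position E-an-237 ⟹ §5 predicts.  CHEAPEST FALSIFIER of E-an-237: one all-even cuspidal representative at a root whose class has
`Λ₁(f) = Λ₀(f)` (none ≤ 2000), or at a non-kernel root of an index-2 class (none ≤ 2000).

HONEST FRAMING.  E-an-237 is OPEN here (stubs α–γ are M-sized, no new idea); E-an-152, E-an-152b, 6b-res, 6b-res♮, 6b‴, C2 `ManinOddAtFour`, C3 and
Manin's conjecture remain OPEN; F★, F♮, CES are printed theorems not formalised here.  PARTITION 2 (kernel theorems modulo named rows) · beyond-print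
theorem: no · BSD is not proved by this.
[cite: Stevens1989, §2] [cite: Newman1959] [cite: Savitt2025, Thm. 1] [cite: ConradEdixhovenStein2003, Thm. 1.1.3] [folklore]

TYPER NOTE (typer g21, T-an-58 LEAF).  SOURCE = HOME/an/g42/EvenKummerShimuraNodes-an-g42.lean sha16 07f0cebb783a2db5 (220 l.; an pre-split the
MEMO-an §87 monolith EvenKummerShimuraPosition-an-g42.lean b0863015abdcba3c (farm rc 0·0·0·0) by import cone; BC7 7/7 CLEAN; BC5 KUMMER×E15 19/19,
0/1028; full memo an/MEMO-an-87.md a442e8523d21ab6d) VERBATIM; the only typer delta is this note.  Imports: `Theorems.ManinLocalTwoThreeSigmaSquareRootLeaves`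
(a Theses-FREE Theorems leaf) + landed `…ManinAdditive.ShimuraKernel`, `…ManinAdditive.CuspidalKummerEvenResidual` + HarnessLib(+Audit.Tags) — typer BFS
of the `import Summits.…` closure: Theses-free (21 modules).  Namespace `…ManinAdditive.KummerShimuraTwo`.  ROWS (an's `@[conjecture]` tags, nothing
asserted): **E-an-237 `EvenKummerRepCongruencePeriodic`**, **S-an-g42-1 `EtaQuotientInvariantOfHalfNewman`** (turnkey P-an-g42-1), **6b-res♮|_A
`CuspidalKummerEvenExponentSquareAtCuspZero`**, **6b-res|_B `CuspidalKummerEvenExponentSquareOnCoreB`**, **E-an-152|_B `ShimuraKernelBlindAtFourB`**,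
**E-an-152b|_B `ShimuraIndexNeFourAtFourB`**, **E-an-153|_B `ShimuraTrivialOfNoBlindAtFourB`**; PROVED restriction edges `cuspidalKummerEvenExponentSquareOnCoreB_of`,
`shimuraKernelBlindAtFourB_of`, `shimuraIndexNeFourAtFourB_of`, `shimuraTrivialOfNoBlindAtFourB_of`.  The COMPANION
`Theorems/ManinLocalTwoThreeEvenKummerShimuraPosition.lean` (source an/g42/EvenKummerShimuraPositionHolds-an-g42.lean d79ed9edc17980b1, `--supports
stmt-…-22967 --as helper`) is a `Theorems/` target — prover/LEAD lane (p1/p2/p3), not the typer's.  REFUTER: ref1 R-an-83 PENDING at landing.  11 decl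
names fresh; cite keys present; no instances, no notation, no sorry.  `--supports` refused for ManinAdditive ⇒ bears_on: stmt-BirchSwinnertonDyer-22967
(C2 `ManinOddAtFour`).  BSD is not proved by this; C2 OPEN.
-/

set_option autoImplicit false

noncomputable section

open scoped PeriodPair MatrixGroups ModularForm NumberField
open Complex PowerSeries CongruenceSubgroup
open IsDedekindDomain IsDedekindDomain.HeightOneSpectrum Rat.HeightOneSpectrum
open WeierstrassCurve Literature.NumberTheory.EllipticCurves Literature.NumberTheory.EllipticCurves.ModularForms
open Summit.BirchSwinnertonDyer.Rank1Residual.ManinAdditive.CuspidalKummer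
open Summit.BirchSwinnertonDyer.Rank1Residual.ManinAdditive.ShimuraKernel
open Summit.BirchSwinnertonDyer.BirchSwinnertonDyer.Theorems.ManinLocalTwoThree.SigmaSquareRoot

namespace Summit.BirchSwinnertonDyer.Rank1Residual.ManinAdditive.KummerShimuraTwo

/-! ## Nodes -/

/-- **E-an-237 `EvenKummerRepCongruencePeriodic`** (THEOREM-CANDIDATE, nothing asserted): an all-even cuspidal Kummer representative of `Ξ_T`
forces the σ-square root of every half-period of `T` to be periodic under `c·{∞,γ∞}_f` for all `γ ∈ Γ₀(N) ∩ Γ(8N)` (the `hcong` of p2's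
NC₂-glue with `M = 8N`).  Route: `√Ξ_T = ±η_{r/2}·(A/B)`, the η-multiplier of `η_{r/2}` is a character of `Γ₀(N)` trivial on `Γ(8N)` (Newman's
congruences hold for `r/2` up to a factor `2`, the square condition is replaced by `d ≡ ±1 (mod 8N)`), then p2's `KummerSquareRootDictionary`.
[cite: Newman1959] [cite: Savitt2025, Thm. 1] [cite: Stevens1989, §2]
[conjecture: this programme — cell bsd-f2-manin E-an-237, prover-sized] -/
@[conjecture]
def EvenKummerRepCongruencePeriodic : Prop :=
  ∀ (W : WeierstrassCurve ℚ) [W.IsElliptic] [W.IsGloballyMinimal] {N : ℕ} [NeZero N]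
    (D : ModularParametrizationData W N) (a : ℕ → ℤ), (∀ n, (a n : ℂ) = cuspCoeff D.f n) →
    ∀ (e : ℤ), W.twoTorsionPolynomial.toPoly.IsRoot (e : ℚ) →
    ∀ z : ℚ⟦X⟧, IsParamGerm W D.c a z →
    ∀ (r : ℕ → ℤ) (g A B : ℤ⟦X⟧), IsCuspidalKummerRep N (kummerSeries W D.c ((e : ℚ)) z) r g A B →
    (∀ δ ∈ N.divisors, Even (r δ)) →
    ∀ (p : ℂ) (m₁ m₂ : ℤ), p ∉ D.L.lattice → 2 * p = m₁ * D.L.ω₁ + m₂ * D.L.ω₂ →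
    ℘[D.L] p = ((e : ℚ) : ℂ) + (W.b₂ : ℂ) / 12 →
    ∀ γ : Gamma0 N, (γ : SL(2, ℤ)) ∈ CongruenceSubgroup.Gamma (8 * N) → ∀ w : ℂ,
      sigmaSqRoot D.L p (m₁ * D.L.η₁ + m₂ * D.L.η₂) (w + (D.c : ℂ) * cuspSymbol D.f γ) =
        sigmaSqRoot D.L p (m₁ * D.L.η₁ + m₂ * D.L.η₂) w

/-- **S-an-g42-1 `EtaQuotientInvariantOfHalfNewman`** (support, M-sized; stub (α) of E-an-237, nothing asserted): an η-quotient
`η_s = ∏_{δ ∣ N} η(δτ)^{s_δ}` whose exponent vector satisfies the three HALVED Newman congruences `Σ s_δ = 0`, `12 ∣ Σ δ·s_δ`, `12 ∣ Σ (N/δ)·s_δ`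
(automatic for `s = r/2` when `r` satisfies `NewmanCond N r 0` with all `r_δ` even) — but NOT necessarily Newman's square condition — is INVARIANT under the
principal congruence subgroup `Γ(8N)`: its `Γ₀(N)`-multiplier `ζ₂₄^{[(a−2d)c/N − bd(c/N)²N]·S₂ + bd·S₁}·(∏ δ^{|s_δ|} / |d|)` (tree: `eta_SL2_smul`,
`etaMultiplier_of_odd_d`, the computation inside `newman_exponent_sum_dvd` / `newman_jacobi_prod_eq_one`) is `1` when `8N ∣ b`, `8N ∣ c` and
`d ≡ ±1 (mod 8N)` (then `(2/|d|) = 1`, and `(ℓ/|d|) = 1` for every odd prime `ℓ ∣ N` by quadratic reciprocity; `c < 0` via `−γ`, `c = 0` via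
`η_s(τ + 8Nk) = η_s(τ)` from `12 ∣ S₁`).  Why it might fail: only a slip in the multiplier bookkeeping — it is the character form of Newman's theorem
(Gordon–Hughes–Newman: `η_s ∣ γ = ((−1)^k ∏ δ^{s_δ} / d)·η_s` on `Γ₀(N)`), restricted to `Γ(8N)` where the quadratic character dies.
[cite: Newman1959] [cite: Savitt2025, Thm. 1] [conjecture: this programme — cell bsd-f2-manin S-an-g42-1, prover-sized] -/
@[conjecture]
def EtaQuotientInvariantOfHalfNewman : Prop :=
  ∀ (N : ℕ), 0 < N → ∀ (s : ℕ → ℤ), ∑ δ ∈ N.divisors, s δ = 0 →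
    (12 : ℤ) ∣ ∑ δ ∈ N.divisors, (δ : ℤ) * s δ → (12 : ℤ) ∣ ∑ δ ∈ N.divisors, ((N / δ : ℕ) : ℤ) * s δ →
    ∀ γ : SL(2, ℤ), γ ∈ CongruenceSubgroup.Gamma (8 * N) → ∀ τ : UpperHalfPlane,
      etaQuotient N s (γ • τ) = etaQuotient N s τ

/-- **6b-res♮|_A `CuspidalKummerEvenExponentSquareAtCuspZero`**: 6b-res♮ `CuspidalKummerEvenExponentSquare` (VERBATIM) with the extra binder
`modularSymbol D.f 0 ∈ periodLattice D.f` (locus A).  A THEOREM modulo E-an-237, F★, F♮, CES (next).  Nothing asserted.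
[conjecture: this programme — cell bsd-f2-manin, 6b-res♮ restricted to locus A] -/
@[conjecture]
def CuspidalKummerEvenExponentSquareAtCuspZero : Prop :=
  ∀ (W : WeierstrassCurve ℚ) [W.IsElliptic] [W.IsGloballyMinimal] {N : ℕ} [NeZero N]
    (D : ModularParametrizationData W N) (a : ℕ → ℤ), (∀ n, (a n : ℂ) = cuspCoeff D.f n) →
    4 ∣ N → (∀ z ∈ D.L.lattice, ∃ w ∈ periodLattice D.f, z = D.c * w) →
    modularSymbol D.f 0 ∈ periodLattice D.f →
    ∀ (a₂ a₄ e : ℤ), W.a₁ = 0 → W.a₃ = 0 → W.a₂ = a₂ → W.a₄ = a₄ →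
    W.twoTorsionPolynomial.toPoly.IsRoot (e : ℚ) → ¬ KummerBlindAtTwo a₂ a₄ e →
    ∀ z : ℚ⟦X⟧, IsParamGerm W D.c a z →
    ∀ (r : ℕ → ℤ) (g A B : ℤ⟦X⟧), IsCuspidalKummerRep N (kummerSeries W D.c ((e : ℚ)) z) r g A B →
    (∀ δ ∈ N.divisors, Even (r δ)) → IsSquare (∏ δ ∈ N.divisors, δ ^ (r δ / 2).natAbs)

/-- **6b-res|_B `CuspidalKummerEvenExponentSquareOnCoreB`** (= the type of the C2 v25 stub `stub_cuspidalKummerEvenExponentSquareOnCoreB`, VERBATIM): 6b-res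
`CuspidalKummerEvenExponentSquareOnCore` with the locus-B binder `modularSymbol D.f 0 ∉ periodLattice D.f`.  EQUIVALENT to 6b-res modulo E-an-237, F★, F♮,
CES (below), and implied by E-an-237 ∧ E-an-152|_B ∧ E-an-152b|_B ∧ print.  Nothing asserted.
[conjecture: this programme — cell bsd-f2-manin, C2 v25 stub 6b-res|_B] -/
@[conjecture]
def CuspidalKummerEvenExponentSquareOnCoreB : Prop :=
  ∀ (W : WeierstrassCurve ℚ) [W.IsElliptic] [W.IsGloballyMinimal] {N : ℕ} [NeZero N]
    (D : ModularParametrizationData W N) (a : ℕ → ℤ), (∀ n, (a n : ℂ) = cuspCoeff D.f n) →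
    2 ^ 4 ∣ N → (∀ z ∈ D.L.lattice, ∃ w ∈ periodLattice D.f, z = D.c * w) →
    ((primesEquiv (R := 𝓞 ℚ)).symm ⟨2, Nat.prime_two⟩).valuation ℚ W.j < 1 →
    (∀ d : ℤ, d = -1 ∨ d = 2 ∨ d = -2 → 2 ≤ (W.quadraticTwist (d : ℚ)).conductorExponent ((primesEquiv (R := ℤ)).symm ⟨2, Nat.prime_two⟩)) →
    modularSymbol D.f 0 ∉ periodLattice D.f →
    ∀ (a₂ a₄ e : ℤ), W.a₁ = 0 → W.a₃ = 0 → W.a₂ = a₂ → W.a₄ = a₄ →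
    W.twoTorsionPolynomial.toPoly.IsRoot (e : ℚ) → ¬ KummerBlindAtTwo a₂ a₄ e →
    ∀ z : ℚ⟦X⟧, IsParamGerm W D.c a z →
    ∀ (r : ℕ → ℤ) (g A B : ℤ⟦X⟧), IsCuspidalKummerRep N (kummerSeries W D.c ((e : ℚ)) z) r g A B →
    (∀ δ ∈ N.divisors, Even (r δ)) → IsSquare (∏ δ ∈ N.divisors, δ ^ (r δ / 2).natAbs)

/-- 6b-res ⟹ 6b-res|_B (restriction). -/
theorem cuspidalKummerEvenExponentSquareOnCoreB_of (h : CuspidalKummerEvenExponentSquareOnCore) :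
    CuspidalKummerEvenExponentSquareOnCoreB :=
  fun W _ _ _N _ D a ha h16 hLat hj hcore _h0 ↦ h W D a ha h16 hLat hj hcore

/-- **E-an-152|_B `ShimuraKernelBlindAtFourB`**: E-an-152 `ShimuraKernelBlindAtFour` with the extra binder `modularSymbol D₀.f 0 ∉ periodLattice D₀.f`
(analytic rank `0`).  Equivalent to E-an-152 modulo F★, F♮, CES (below).  Nothing asserted. [cite: Stevens1989, §2] -/
@[conjecture]
def ShimuraKernelBlindAtFourB : Prop :=
  ∀ (W₀ : WeierstrassCurve ℚ) [W₀.IsElliptic] [W₀.IsGloballyMinimal] {N : ℕ} [NeZero N]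
    (D₀ : ModularParametrizationData W₀ N),
    (∀ z ∈ D₀.L.lattice, ∃ w ∈ periodLattice D₀.f, z = D₀.c * w) → 2 ^ 2 ∣ N →
    modularSymbol D₀.f 0 ∉ periodLattice D₀.f → W₀.a₁ = 0 → W₀.a₃ = 0 →
    periodLatticeGamma1 D₀.f ≠ periodLattice D₀.f →
    ∀ w ∈ periodLatticeGamma1 D₀.f, (∀ v ∈ periodLattice D₀.f, w ≠ 2 * v) →
      ∃ A₂ A₄ E : ℤ, (A₂ : ℚ) = W₀.a₂ ∧ (A₄ : ℚ) = W₀.a₄ ∧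
        (E : ℚ) ^ 3 + W₀.a₂ * (E : ℚ) ^ 2 + W₀.a₄ * E + W₀.a₆ = 0 ∧
        D₀.L.weierstrassP ((D₀.c : ℂ) * w / 2) = (((E : ℚ) + W₀.a₂ / 3 : ℚ) : ℂ) ∧ KummerBlindAtTwo A₂ A₄ E

/-- **E-an-152b|_B `ShimuraIndexNeFourAtFourB`**: E-an-152b with the extra binder `modularSymbol D₀.f 0 ∉ periodLattice D₀.f`.  Nothing asserted. -/
@[conjecture]
def ShimuraIndexNeFourAtFourB : Prop :=
  ∀ (W₀ : WeierstrassCurve ℚ) [W₀.IsElliptic] [W₀.IsGloballyMinimal] {N : ℕ} [NeZero N]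
    (D₀ : ModularParametrizationData W₀ N),
    (∀ z ∈ D₀.L.lattice, ∃ w ∈ periodLattice D₀.f, z = D₀.c * w) → 2 ^ 2 ∣ N →
    modularSymbol D₀.f 0 ∉ periodLattice D₀.f →
    ¬ (∀ z : ℂ, z ∈ periodLatticeGamma1 D₀.f ↔ ∃ w ∈ periodLattice D₀.f, z = 2 * w)

/-- **E-an-153|_B `ShimuraTrivialOfNoBlindAtFourB`**: E-an-153 with the extra binder `modularSymbol D₀.f 0 ∉ periodLattice D₀.f`.  Nothing asserted. -/
@[conjecture]
def ShimuraTrivialOfNoBlindAtFourB : Prop :=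
  ∀ (W₀ : WeierstrassCurve ℚ) [W₀.IsElliptic] [W₀.IsGloballyMinimal] {N : ℕ} [NeZero N]
    (D₀ : ModularParametrizationData W₀ N),
    (∀ z ∈ D₀.L.lattice, ∃ w ∈ periodLattice D₀.f, z = D₀.c * w) → 2 ^ 2 ∣ N →
    modularSymbol D₀.f 0 ∉ periodLattice D₀.f → W₀.a₁ = 0 → W₀.a₃ = 0 →
    (∀ A₂ A₄ E : ℤ, (A₂ : ℚ) = W₀.a₂ → (A₄ : ℚ) = W₀.a₄ →
      (E : ℚ) ^ 3 + W₀.a₂ * (E : ℚ) ^ 2 + W₀.a₄ * E + W₀.a₆ = 0 → ¬ KummerBlindAtTwo A₂ A₄ E) →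
    periodLatticeGamma1 D₀.f = periodLattice D₀.f

/-- E-an-152 ⟹ E-an-152|_B (restriction). -/
theorem shimuraKernelBlindAtFourB_of (h : ShimuraKernelBlindAtFour) : ShimuraKernelBlindAtFourB :=
  fun W₀ _ _ _N _ D₀ hopt h4 _h0 ↦ h W₀ D₀ hopt h4

/-- E-an-152b ⟹ E-an-152b|_B (restriction). -/
theorem shimuraIndexNeFourAtFourB_of (h : ShimuraIndexNeFourAtFour) : ShimuraIndexNeFourAtFourB :=
  fun W₀ _ _ _N _ D₀ hopt h4 _h0 ↦ h W₀ D₀ hopt h4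

/-- E-an-153 ⟹ E-an-153|_B (restriction). -/
theorem shimuraTrivialOfNoBlindAtFourB_of (h : ShimuraTrivialOfNoBlindAtFour) : ShimuraTrivialOfNoBlindAtFourB :=
  fun W₀ _ _ _N _ D₀ hopt h4 _h0 ↦ h W₀ D₀ hopt h4

end Summit.BirchSwinnertonDyer.Rank1Residual.ManinAdditive.KummerShimuraTwo

end
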